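import Summits.QuantumFields.YangMills.Theorems.BalabanUVNodesK2CornerRoadLine2

/-!
# PORT-9 apply twin (crux workfile, cell `ym-nodeO-ideate`, seat `ym-nodeO-port-1` gen 5): by-name checks of
# `Theorems/BalabanUVNodesK2CornerRoadLine2.lean` against the REGISTERED K1 v9 LINE-2 stub signatures (DEF-1 `K1V9Defs` names) and the corner road's older currencies

Carrier item stmt-QuantumFields-20543 (aside); bears on the DECIDING K1⁹ stmt-QuantumFields-27364 (v9 e3ea62ca8052a293, LINE 2).  `example`s only; nothing asserted; no stub closed;
the YM mass gap (Clay) is NOT proved by any of this.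

* A1 the registered `stub_runRows13PWSV` signature, printed over the tree names, under {ceiling lift, U3ᴷ-lite, anchored positive drift};
* A2 the registered `stub_cont13V` signature under the moduli letter alone (unity-keyed) and A2′ (unity-free, through `Cont13All`);
* A3 K1⁹ BY NAME through DEF-1's `…_of_stubTextsV` with `h₁` = the registered `stub_nodes13PWSV` signature; A4 the same with the lift discharged to N11CU at the slot world;
* B1 LINE 1 ⟹ LINE 2 at the trivial slot: a `K1V6Defs.RecordS` world feeds the LINE-2 producer through `K1V9Defs.recordSV_refl_iff`;
* B4 LINE 1's N11CU letter at an `RecordS` datum gives the LINE-2 ceiling-keyed family at `refl`;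
* B2∕B3 letters keyed on the record datum's `βfun` (p622247 currency) or on the slot datum's `βfun` (p626226 currency) feed the θ-level hypotheses by `rfl`.
-/

namespace Summit.QuantumFields.YangMills.Cruxes.EndpointGivenBR13SepCoPH.Port9CornerRoadLine2Apply

open Literature.MathematicalPhysics.QuantumFieldTheory.Balaban1983to89
open Literature.MathematicalPhysics.QuantumFieldTheory.Balaban1983to89.T4Continuum
open Literature.MathematicalPhysics.QuantumFieldTheory.Balaban1983to89.DagBinding
open Literature.MathematicalPhysics.QuantumFieldTheory.Balaban1983to89.FlowStep
open Literature.MathematicalPhysics.QuantumFieldTheory.Balaban1983to89.FlowStepRuns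
open Literature.MathematicalPhysics.QuantumFieldTheory.Balaban1983to89.T4CouplingMatching (HistLipschitz)
open Literature.MathematicalPhysics.QuantumFieldTheory.Balaban1983to89.Beta.Drift (OneLoopDrift)
open Summit.QuantumFields.YangMills.Theorems.BalabanUVNodesK2NamedJetsRemAt (ScaleAnchor)
open Summit.QuantumFields.YangMills.Theorems.BalabanUVNodesK2NamedJetsRunRemAt (RunConstRemainder SurvCont)
open Summit.QuantumFields.YangMills.Theorems.K1V6Defs (RecordS Inhabited13)
open Summit.QuantumFields.YangMills.Theorems.K1V9Defs
open Summit.QuantumFields.YangMills.Theses.BalabanUVNodes (StabilityBRunRowsAtRecordR13SepCoPHV)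
open Summit.QuantumFields.YangMills.Theorems.BalabanUVNodesK2CornerRoadLine2

/-- A1: `stub_runRows13PWSV : ∀ F : T4Family, NodesAtSomeRecord13PWSV F → RunRowsAtSomeRecord13PWSV F` (v9 :443, registered) under the three letters. -/
example
    (hLift : ∀ (F : T4Family) (θ : Node00.Stage13HParams F 2) (h : θ.Provisos₁₃SepCoPH F 2) (v : Node00.Revision₁₃ F 2 θ h) (w : WorldP),
      (θ.ZhUnity F 2 ∧ θ.SlotsNondegenerate₁₃ F 2) → θ.Admissible F 2 → RecordSV F θ h v w → (∀ P : B12.RunParams, Nodes (leavesP w P)) →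
      ∀ c : ℝ, ∃ w' : WorldP, c ≤ w'.βup ∧ RecordSV F θ h v w' ∧ ∀ P : B12.RunParams, Nodes (leavesP w' P))
    (hLite : ∀ (F : T4Family) (θ : Node00.Stage13HParams F 2), θ.Provisos₁₃SepCoPH F 2 → (θ.ZhUnity F 2 ∧ θ.SlotsNondegenerate₁₃ F 2) → θ.Admissible F 2 →
      ∃ (Λ : ℕ → ℕ → ℝ) (M : ℝ), HistLipschitz Λ θ.γ (Node00.betaOfRecord₁₃ F 2 θ.toStage13Params) ∧ ∀ k, ∑ i : Fin (k + 1), |Λ k i| ≤ M)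
    (hCD : ∀ (F : T4Family) (θ : Node00.Stage13HParams F 2), θ.Provisos₁₃SepCoPH F 2 → (θ.ZhUnity F 2 ∧ θ.SlotsNondegenerate₁₃ F 2) → θ.Admissible F 2 →
      ∃ (b : ℕ → ℝ) (s A : ℝ), ScaleAnchor (Node00.betaOfRecord₁₃ F 2 θ.toStage13Params) b ∧ 0 < s ∧ OneLoopDrift s A b) :
    ∀ F : T4Family, NodesAtSomeRecord13PWSV F → RunRowsAtSomeRecord13PWSV F :=
  stub_runRows13PWSVText_of_ceilingLiftV_liteText_cornerText hLift hLite hCD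

/-- A2: `stub_cont13V : ∀ F : T4Family, RunRowsAtSomeRecord13PWSV F → RunRowsContAtSomeRecord13PWSV F` (v9 :450, registered) under the moduli letter alone (unity-keyed). -/
example
    (hMod : ∀ (F : T4Family) (θ : Node00.Stage13HParams F 2), θ.Provisos₁₃SepCoPH F 2 → (θ.ZhUnity F 2 ∧ θ.SlotsNondegenerate₁₃ F 2) → θ.Admissible F 2 →
      ∃ Λ : ℕ → ℕ → ℝ, HistLipschitz Λ θ.γ (Node00.betaOfRecord₁₃ F 2 θ.toStage13Params)) :
    ∀ F : T4Family, RunRowsAtSomeRecord13PWSV F → RunRowsContAtSomeRecord13PWSV F :=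
  stub_cont13VText_of_histModuliU hMod

/-- A2′: the same under the unity-free moduli letter keyed on the RECORD datum's `βfun` (p621195's `cont13All_of_histModuliK` currency), by `rfl` on `Node00.βfun_datumOfRecord₁₃SepCoPH`. -/
example
    (hMod : ∀ (F : T4Family) (θ : Node00.Stage13HParams F 2) (hP : θ.Provisos₁₃SepCoPH F 2), θ.Admissible F 2 →
      ∃ Λ : ℕ → ℕ → ℝ, HistLipschitz Λ θ.γ (Node00.datumOfRecord₁₃SepCoPH F 2 θ hP).βfun) :
    ∀ F : T4Family, RunRowsAtSomeRecord13PWSV F → RunRowsContAtSomeRecord13PWSV F :=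
  stub_cont13VText_of_histModuli fun F θ hP hθ => hMod F θ hP hθ

/-- A3: K1⁹ BY NAME with `h₁` = the registered `stub_nodes13PWSV` signature `∀ F : T4Family, Inhabited13 F → NodesAtSomeRecord13PWSV F` (v9 :435). -/
example
    (h₁ : ∀ F : T4Family, Inhabited13 F → NodesAtSomeRecord13PWSV F)
    (hLift : ∀ (F : T4Family) (θ : Node00.Stage13HParams F 2) (h : θ.Provisos₁₃SepCoPH F 2) (v : Node00.Revision₁₃ F 2 θ h) (w : WorldP),
      (θ.ZhUnity F 2 ∧ θ.SlotsNondegenerate₁₃ F 2) → θ.Admissible F 2 → RecordSV F θ h v w → (∀ P : B12.RunParams, Nodes (leavesP w P)) →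
      ∀ c : ℝ, ∃ w' : WorldP, c ≤ w'.βup ∧ RecordSV F θ h v w' ∧ ∀ P : B12.RunParams, Nodes (leavesP w' P))
    (hLite : ∀ (F : T4Family) (θ : Node00.Stage13HParams F 2), θ.Provisos₁₃SepCoPH F 2 → (θ.ZhUnity F 2 ∧ θ.SlotsNondegenerate₁₃ F 2) → θ.Admissible F 2 →
      ∃ (Λ : ℕ → ℕ → ℝ) (M : ℝ), HistLipschitz Λ θ.γ (Node00.betaOfRecord₁₃ F 2 θ.toStage13Params) ∧ ∀ k, ∑ i : Fin (k + 1), |Λ k i| ≤ M)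
    (hCD : ∀ (F : T4Family) (θ : Node00.Stage13HParams F 2), θ.Provisos₁₃SepCoPH F 2 → (θ.ZhUnity F 2 ∧ θ.SlotsNondegenerate₁₃ F 2) → θ.Admissible F 2 →
      ∃ (b : ℕ → ℝ) (s A : ℝ), ScaleAnchor (Node00.betaOfRecord₁₃ F 2 θ.toStage13Params) b ∧ 0 < s ∧ OneLoopDrift s A b) :
    Summit.QuantumFields.YangMills.Theses.BalabanUVNodes.StabilityBRunRowsAtRecordR13SepCoPHV :=
  stabilityBRunRowsAtRecordR13SepCoPHV_of_stubTextsV_cornerRoad h₁ hLift hLite hCD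

/-- B1: LINE 1 ⟹ LINE 2 at the trivial slot `Revision₁₃.refl` — an `RecordS` world (LINE 1's rung-1 class) feeds the LINE-2 producer through DEF-1's `recordSV_refl_iff`. -/
example {F : T4Family} (θ : Node00.Stage13HParams F 2) (h : θ.Provisos₁₃SepCoPH F 2) (w : WorldP)
    (hU : θ.ZhUnity F 2 ∧ θ.SlotsNondegenerate₁₃ F 2) (hθ : θ.Admissible F 2) (hR : RecordS F θ h w) (hnodes : ∀ P : B12.RunParams, Nodes (leavesP w P))
    {Λ : ℕ → ℕ → ℝ} {M : ℝ} (hL : HistLipschitz Λ θ.γ (Node00.betaOfRecord₁₃ F 2 θ.toStage13Params)) (hM : ∀ k, ∑ i : Fin (k + 1), |Λ k i| ≤ M)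
    {b : ℕ → ℝ} {s A : ℝ} (hb : ScaleAnchor (Node00.betaOfRecord₁₃ F 2 θ.toStage13Params) b) (hs : 0 < s) (hdrift : OneLoopDrift s A b) (hmatch : s + 2 * A < w.βup) :
    RunRowsContAtSomeRecord13PWSV F :=
  runRowsContAtSomeRecord13PWSV_of_rung1VAt_cornerLetters_lt θ h (Node00.Revision₁₃.refl F 2 θ h) w hU hθ ((recordSV_refl_iff θ h w).2 hR) hnodes hL hM hb hs hdrift hmatch

/-- B2: letters keyed on the RECORD datum's `βfun` (p622247's currency) feed the θ-level hypotheses (`Node00.βfun_datumOfRecord₁₃SepCoPH` is `rfl`). -/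
example {F : T4Family} (θ : Node00.Stage13HParams F 2) (h : θ.Provisos₁₃SepCoPH F 2) (hθ : θ.Admissible F 2)
    {Λ : ℕ → ℕ → ℝ} {M : ℝ} (hL : HistLipschitz Λ θ.γ (Node00.datumOfRecord₁₃SepCoPH F 2 θ h).βfun) (hM : ∀ k, ∑ i : Fin (k + 1), |Λ k i| ≤ M)
    {b : ℕ → ℝ} {s A : ℝ} (hb : ScaleAnchor (Node00.datumOfRecord₁₃SepCoPH F 2 θ h).βfun b) (hs : 0 < s) (hdrift : OneLoopDrift s A b) {c : ℝ} (hc : s + 2 * A < c) :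
    ∃ (b : ℕ → ℝ) (r γ₀ B M : ℝ), 0 < γ₀ ∧ RunConstRemainder (Node00.betaOfRecord₁₃ F 2 θ.toStage13Params) b r γ₀ ∧ (∀ k, b k ≤ B) ∧ B + r ≤ c ∧
      (∀ (n : ℕ) (gs : ℕ → ℝ), RGEqH n (Node00.betaOfRecord₁₃ F 2 θ.toStage13Params) gs → Step.InInterval γ₀ n gs →
        ∀ k, k ≤ n → -M ≤ ∑ j ∈ Finset.Ico k n, Node00.betaOfRecord₁₃ F 2 θ.toStage13Params j (prefixOf gs j)) ∧
      SurvCont (Node00.betaOfRecord₁₃ F 2 θ.toStage13Params) γ₀ :=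
  runLettersAtCeiling_at θ hθ hL hM hb hs hdrift hc

/-- B3: letters keyed on the SLOT datum's `βfun` (p626226's slot-text currency) feed them too (`Node00.βfun_datumOfRecord₁₃SepCoPHV` is `rfl`). -/
example {F : T4Family} (θ : Node00.Stage13HParams F 2) (h : θ.Provisos₁₃SepCoPH F 2) (v : Node00.Revision₁₃ F 2 θ h) (hθ : θ.Admissible F 2)
    {Λ : ℕ → ℕ → ℝ} {M : ℝ} (hL : HistLipschitz Λ θ.γ (Node00.datumOfRecord₁₃SepCoPHV F 2 θ h v).βfun) (hM : ∀ k, ∑ i : Fin (k + 1), |Λ k i| ≤ M)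
    {b : ℕ → ℝ} {s A : ℝ} (hb : ScaleAnchor (Node00.datumOfRecord₁₃SepCoPHV F 2 θ h v).βfun b) (hs : 0 < s) (hdrift : OneLoopDrift s A b) {c : ℝ} (hc : s + 2 * A < c) :
    ∃ (b : ℕ → ℝ) (r γ₀ B M : ℝ), 0 < γ₀ ∧ RunConstRemainder (Node00.betaOfRecord₁₃ F 2 θ.toStage13Params) b r γ₀ ∧ (∀ k, b k ≤ B) ∧ B + r ≤ c ∧
      (∀ (n : ℕ) (gs : ℕ → ℝ), RGEqH n (Node00.betaOfRecord₁₃ F 2 θ.toStage13Params) gs → Step.InInterval γ₀ n gs →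
        ∀ k, k ≤ n → -M ≤ ∑ j ∈ Finset.Ico k n, Node00.betaOfRecord₁₃ F 2 θ.toStage13Params j (prefixOf gs j)) ∧
      SurvCont (Node00.betaOfRecord₁₃ F 2 θ.toStage13Params) γ₀ :=
  runLettersAtCeiling_at θ hθ hL hM hb hs hdrift hc

/-- A4: K1⁹ BY NAME with `h₁` = the registered `stub_nodes13PWSV` signature and the ceiling lift DISCHARGED to «N11 ceiling-uniform at rung-1ⱽ core data» (one node). -/
example
    (h₁ : ∀ F : T4Family, Inhabited13 F → NodesAtSomeRecord13PWSV F)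
    (hN11V : ∀ (F : T4Family) (θ : Node00.Stage13HParams F 2) (h : θ.Provisos₁₃SepCoPH F 2) (v : Node00.Revision₁₃ F 2 θ h) (w : WorldP),
      (θ.ZhUnity F 2 ∧ θ.SlotsNondegenerate₁₃ F 2) → θ.Admissible F 2 → RecordSV F θ h v w → (∀ P : B12.RunParams, Nodes (leavesP w P)) →
      ∀ c : ℝ, ∃ γ' : ℝ, 0 < γ' ∧ γ' ≤ w.γ ∧ ∀ P : B12.RunParams, Dag.B14_main (leavesP { w with βup := c, γ := γ' } P))
    (hLite : ∀ (F : T4Family) (θ : Node00.Stage13HParams F 2), θ.Provisos₁₃SepCoPH F 2 → (θ.ZhUnity F 2 ∧ θ.SlotsNondegenerate₁₃ F 2) → θ.Admissible F 2 →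
      ∃ (Λ : ℕ → ℕ → ℝ) (M : ℝ), HistLipschitz Λ θ.γ (Node00.betaOfRecord₁₃ F 2 θ.toStage13Params) ∧ ∀ k, ∑ i : Fin (k + 1), |Λ k i| ≤ M)
    (hCD : ∀ (F : T4Family) (θ : Node00.Stage13HParams F 2), θ.Provisos₁₃SepCoPH F 2 → (θ.ZhUnity F 2 ∧ θ.SlotsNondegenerate₁₃ F 2) → θ.Admissible F 2 →
      ∃ (b : ℕ → ℝ) (s A : ℝ), ScaleAnchor (Node00.betaOfRecord₁₃ F 2 θ.toStage13Params) b ∧ 0 < s ∧ OneLoopDrift s A b) :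
    Summit.QuantumFields.YangMills.Theses.BalabanUVNodes.StabilityBRunRowsAtRecordR13SepCoPHV :=
  stabilityBRunRowsAtRecordR13SepCoPHV_of_stub1VText_n11CUV_liteText_cornerText h₁ hN11V hLite hCD

/-- B4: at the trivial slot, LINE 1's N11CU letter at an `RecordS` core datum (CRIT-1's `hN11` shape in `K1RunRowsTextOfN11CUOfRowsWF`) gives the LINE-2 ceiling-keyed family through the `refl` door. -/
example {F : T4Family} (θ : Node00.Stage13HParams F 2) (h : θ.Provisos₁₃SepCoPH F 2) (w : WorldP) (hR : RecordS F θ h w) (hnodes : ∀ P : B12.RunParams, Nodes (leavesP w P))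
    (hraise : ∀ c : ℝ, ∃ γ' : ℝ, 0 < γ' ∧ γ' ≤ w.γ ∧ ∀ P : B12.RunParams, Dag.B14_main (leavesP { w with βup := c, γ := γ' } P)) :
    ∀ c : ℝ, ∃ w' : WorldP, c ≤ w'.βup ∧ RecordSV F θ h (Node00.Revision₁₃.refl F 2 θ h) w' ∧ ∀ P : B12.RunParams, Nodes (leavesP w' P) :=
  ceilingKeyedRung1V_of_nodes_of_b14Raise θ h (Node00.Revision₁₃.refl F 2 θ h) w ((recordSV_refl_iff θ h w).2 hR) hnodes hraise

end Summit.QuantumFields.YangMills.Cruxes.EndpointGivenBR13SepCoPH.Port9CornerRoadLine2Apply
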